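import Summits.ABC.StewartYu.PadicW80Numeric
import HarnessLib

/-!
# The `p`-adic Waldschmidt numerics — part B: the half step and the rooms

Support file (theorems only), sequel of `PadicW80Numeric`: `halfstep_ineq_one/two` (the two
logarithmic inequalities of p3's `hFinalHalf_of_log_ineq` at `kpts' = 2^{d+J}S₀/2`, for any
threshold budget `B ≤ (7/16)·2ᵈ𝔘`); the room lemma `room_half` is in `PadicW80ParF`.
[cite: Waldschmidt1980, Lemma 3.7 (pp. 272–273)]
-/

noncomputable section

open Finset Real
open Literature.NumberTheory.Transcendental Literature.NumberTheory.Transcendental.Waldschmidt1980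

namespace Summit.ABC.StewartYu

namespace PadicW80Par

variable {d : ℕ} (P : PadicW80Par d)

omit P in
/-- `log p ≤ p − 1`. [folklore] -/
private theorem log_le_sub_one_nat' {p : ℕ} (hp : 2 ≤ p) : Real.log p ≤ (p : ℝ) - 1 :=
  Real.log_le_sub_one_of_pos (by exact_mod_cast (by omega : 0 < p))

omit P in
/-- `1 ≤ log p` for `p ≥ 3` (`e < 3`). [folklore] -/
private theorem one_le_log_nat' {p : ℕ} (hp : 3 ≤ p) : (1 : ℝ) ≤ Real.log p := by
  rw [Real.le_log_iff_exp_le (by exact_mod_cast (by omega : 0 < p))]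
  have := Real.exp_one_lt_d9
  have h3 : (3 : ℝ) ≤ p := by exact_mod_cast hp
  linarith

/-! ### The half-step inequalities (targets of `hFinalHalf_of_log_ineq`) -/

/-- **Half step, smallness branch (1)**: with `kpts' = 2^{d+J}S₀/2`, `t = t_J` and any threshold
budget `B ≤ (7/16)·2ᵈ𝔘`: `(⌊hL_b/(p−1)⌋ + ⌊(t−1)/(p−1)⌋ + cond')·log p + B < U`.
[cite: Waldschmidt1980, Lemma 3.7 (pp. 272–273)] -/
theorem halfstep_ineq_one {p : ℕ} (hp : 3 ≤ p) {J : ℕ} (hJ : J < P.J₀p) {B : ℝ}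
    (hB : B ≤ 7 / 16 * (2 ^ d * P.𝔘p)) :
    ((P.hparp * P.Lbp / (p - 1) + (P.tJp J - 1) / (p - 1) +
        ∑ j ∈ range (Nat.log p (2 * (2 ^ (d + J) * P.S₀p / 2))),
          P.tJp J * ((2 ^ (d + J) * P.S₀p / 2) / p ^ (j + 1) + 1) : ℕ) : ℝ) * Real.log p + B <
      P.Up := by
  have hp2 : 2 ≤ p := by omega
  have hp1 : (1 : ℝ) < p := by exact_mod_cast (by omega : 1 < p)
  have hlogp1 := one_le_log_nat' hp
  have hlogp0 : 0 ≤ Real.log p := by linarith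
  have hlps := log_le_sub_one_nat' hp2
  have hpm1 : (0 : ℝ) < (p : ℝ) - 1 := by linarith
  have hU := P.𝔘_pos; have hW := P.one_le_Wstar; have hWU := P.Wstar_le_𝔘
  have hhLb := P.hparLb_le; have hT := P.T_le_𝔘; have hTpos := P.T_pos
  have hKT := P.KT_le J d
  have htl := P.t_mul_log_kpts_le hJ le_rfl
  set kpts : ℕ := 2 ^ (d + J) * P.S₀p / 2 with hkpts
  set t : ℕ := P.tJp J with ht
  have hk1 : 1 ≤ kpts := by
    rw [hkpts, Nat.le_div_iff_mul_le two_pos]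
    calc 1 * 2 = 2 := by ring
      _ ≤ 2 ^ (d + J) * 2 := Nat.le_mul_of_pos_left 2 (Nat.pow_pos two_pos)
      _ ≤ 2 ^ (d + J) * P.S₀p := Nat.mul_le_mul_left _ P.two_le_S₀
  have htT : (t : ℝ) ≤ P.Tp := by exact_mod_cast P.tJ_le_T J
  have hc1 : ((P.hparp * P.Lbp / (p - 1) : ℕ) : ℝ) ≤ (P.hparp : ℝ) * P.Lbp / ((p : ℝ) - 1) := by
    have h := Nat.cast_div_le (α := ℝ) (m := P.hparp * P.Lbp) (n := p - 1)
    have e : ((p - 1 : ℕ) : ℝ) = (p : ℝ) - 1 := by rw [Nat.cast_sub (by omega)]; simp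
    rw [e] at h; push_cast at h; exact h
  have hc2 : (((t - 1) / (p - 1) : ℕ) : ℝ) ≤ (t : ℝ) / ((p : ℝ) - 1) := by
    have h := Nat.cast_div_le (α := ℝ) (m := t - 1) (n := p - 1)
    have e : ((p - 1 : ℕ) : ℝ) = (p : ℝ) - 1 := by rw [Nat.cast_sub (by omega)]; simp
    rw [e] at h
    have h2 : ((t - 1 : ℕ) : ℝ) ≤ t := by exact_mod_cast Nat.sub_le t 1
    exact h.trans (div_le_div_of_nonneg_right h2 hpm1.le)
  have hcond := condSum_mul_log_le hp2 kpts t hk1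
  have hdiv : ∀ x : ℝ, 0 ≤ x → x / ((p : ℝ) - 1) * Real.log p ≤ x := by
    intro x hx
    rw [div_mul_eq_mul_div, div_le_iff₀ hpm1]
    exact mul_le_mul_of_nonneg_left hlps hx
  have hhLb0 : (0 : ℝ) ≤ (P.hparp : ℝ) * P.Lbp := by positivity
  have ht0 : (0 : ℝ) ≤ t := Nat.cast_nonneg _
  have hkt0 : (0 : ℝ) ≤ (kpts : ℝ) * t := by positivity
  have hsum : ((P.hparp * P.Lbp / (p - 1) + (t - 1) / (p - 1) +
        ∑ j ∈ range (Nat.log p (2 * kpts)), t * (kpts / p ^ (j + 1) + 1) : ℕ) : ℝ) * Real.log p ≤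
      (P.hparp : ℝ) * P.Lbp + t + ((kpts : ℝ) * t + P.𝔘p / 128) := by
    have e1 := hdiv _ hhLb0
    have e2 := hdiv _ ht0
    have hA : ((P.hparp * P.Lbp / (p - 1) : ℕ) : ℝ) * Real.log p ≤ (P.hparp : ℝ) * P.Lbp :=
      (mul_le_mul_of_nonneg_right hc1 hlogp0).trans e1
    have hB' : (((t - 1) / (p - 1) : ℕ) : ℝ) * Real.log p ≤ t :=
      (mul_le_mul_of_nonneg_right hc2 hlogp0).trans e2
    have hC : ((∑ j ∈ range (Nat.log p (2 * kpts)), t * (kpts / p ^ (j + 1) + 1) : ℕ) : ℝ) *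
        Real.log p ≤ (kpts : ℝ) * t + P.𝔘p / 128 := by
      refine hcond.trans ?_
      have e3 : ((kpts : ℝ) * t * Real.log p / ((p : ℝ) - 1)) ≤ (kpts : ℝ) * t := by
        have := hdiv _ hkt0; rwa [div_mul_eq_mul_div] at this
      have := htl
      linarith
    have esplit : ((P.hparp * P.Lbp / (p - 1) + (t - 1) / (p - 1) +
          ∑ j ∈ range (Nat.log p (2 * kpts)), t * (kpts / p ^ (j + 1) + 1) : ℕ) : ℝ) * Real.log p =
        ((P.hparp * P.Lbp / (p - 1) : ℕ) : ℝ) * Real.log p + (((t - 1) / (p - 1) : ℕ) : ℝ) * Real.log p +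
          ((∑ j ∈ range (Nat.log p (2 * kpts)), t * (kpts / p ^ (j + 1) + 1) : ℕ) : ℝ) * Real.log p := by
      push_cast; ring
    rw [esplit]
    linarith
  have hkt : (kpts : ℝ) * t ≤ 2 ^ d * P.𝔘p := hKT
  rw [P.U_eq, pow_succ]
  have h2d : (1 : ℝ) ≤ 2 ^ d := one_le_pow₀ (by norm_num)
  have h5 : P.𝔘p ≤ 2 ^ d * P.𝔘p := by nlinarith
  have e2 : (2 : ℝ) ^ d * 2 * P.𝔘p = 2 * (2 ^ d * P.𝔘p) := by ring
  rw [e2]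
  unfold cLp at hhLb; unfold cTp at hT
  have : (P.hparp : ℝ) * P.Lbp + t + ((kpts : ℝ) * t + P.𝔘p / 128) + B < 2 * (2 ^ d * P.𝔘p) := by
    linarith
  linarith

/-- **Half step, gain branch (2)**: `hL_b·log p + B < (kpts'·t/2)·log p` for `kpts' = 2^{d+J}S₀/2`,
`t = t_J`, `J < J₀`, and any threshold budget `B ≤ (7/16)·2ᵈ𝔘`.
[cite: Waldschmidt1980, Lemma 3.7 (pp. 272–273)] -/
theorem halfstep_ineq_two {p : ℕ} (hp : 3 ≤ p) {J : ℕ} (hJ : J < P.J₀p) {B : ℝ}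
    (hB : B ≤ 7 / 16 * (2 ^ d * P.𝔘p)) :
    ((P.hparp * P.Lbp : ℕ) : ℝ) * Real.log p + B <
      (((2 ^ (d + J) * P.S₀p / 2) * P.tJp J : ℕ) : ℝ) / 2 * Real.log p := by
  have hlogp1 := one_le_log_nat' hp
  have hU := P.𝔘_pos; have hW := P.one_le_Wstar; have hWU := P.Wstar_le_𝔘
  have hhLb := P.hparLb_le
  have hKT := P.KT_ge hJ d
  push_cast at hKT ⊢
  have h2d : (1 : ℝ) ≤ 2 ^ d := one_le_pow₀ (by norm_num)
  have key : (P.hparp : ℝ) * P.Lbp + 7 / 16 * (2 ^ d * P.𝔘p) < 31 / 32 * (2 ^ d * P.𝔘p) / 2 := by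
    unfold cLp at hhLb; nlinarith
  have h0' : (0 : ℝ) ≤ (P.hparp : ℝ) * P.Lbp := by positivity
  rcases le_or_gt 0 B with hB0 | hB0
  · have hX : B ≤ B * Real.log p := by nlinarith
    nlinarith [mul_le_mul_of_nonneg_right hKT (le_trans zero_le_one hlogp1)]
  · nlinarith [mul_le_mul_of_nonneg_right hKT (le_trans zero_le_one hlogp1)]

end PadicW80Par

end Summit.ABC.StewartYu

end
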